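import Literature.NumberTheory.ComplexMultiplication.MainTheoremTorsionReciprocityHom
import Literature.NumberTheory.NumberFields.RootOfUnityCongruence
import Literature.NumberTheory.NumberFields.FiniteIdeleCongruenceSubgroupBasis
import Literature.NumberTheory.NumberFields.FiniteIdeleHomIdealDescent
import Literature.NumberTheory.NumberFields.RayClassFieldIdelic
import Literature.NumberTheory.GaloisRepresentations.UnitIdeles
import Literature.NumberTheory.ComplexMultiplication.ArtinLiftVersusArtinCorrespondent
import Mathlib.Topology.Baire.Lemmas
import Mathlib.Topology.Baire.LocallyCompactRegular
import HarnessLib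

/-!
# «`Ker(α)` is open in `k_𝐀^×`» (Shimura 1998, Thm. 19.8, last assertion) — from the reciprocity relation alone

Topic `Literature/NumberTheory/ComplexMultiplication`, namespace `Literature.NumberTheory.ComplexMultiplication`.  Cell
`hodgecm-mathlib` (D-0151), fan A, rung A-II, row II-5 programme, FILE C (sequel of FILES B1–B2
`…MainTheoremTorsionGaloisAction`, `…MainTheoremTorsionReciprocityHom`).  THEOREMS ONLY (no definition, no named fact; net debt 0).

THE PRINT AND THE DEVIATION.  [Shimura1998] Thm. 19.8 (p. 134): «there exists a homomorphism `α : k_𝐀^× → K^×` such that `Ker(α)`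
is open in `k_𝐀^×` …»; the printed proof (p. 136) derives openness from «`αα^ρ = 1`, and hence `α` is a root of unity … `(α − 1)𝔞 ⊂ m𝔞`.
Since `m > 2` we have `α = 1`», where «`αα^ρ = N(x𝔤)`» comes from the POLARISATION clause `ζ′ = N(s𝔯)ζ` of Thm. 18.6 (1) through
`E_X(Tu, Tv) = N(yv)E_X(u, v)` (p. 135).  The tree's `shimura1998_thm18_6` does not record that clause, so this file proves
openness from the reciprocity relation «`r(w)^{[x,k]} = r(α(x)f(x)⁻¹w)`» ALONE, replacing «`α` is a root of unity» by a
compactness argument: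
1. (`exists_isOpen_subgroup_forall_mem_congruenceUnits`) for every `M ≥ 1` there is an OPEN subgroup `V_M ≤ k_𝐀^×` on which the
   multiplier `c(x) = α(x)f(x)⁻¹` lies in the congruence subgroup `I^{(M)}` of the finite idèles of `K`: `V_M` is the preimage under
   the (continuous, arithmetic) Artin map `[·, k]` of the image in `Gal(k_ab/k)` of the open subgroup `Gal(k̄/k(A₀[M]))`
   (`isOpen_torsionFixingSubgroup`) — for such `x` some Artin lift fixes `A₀[M](ℂ)` (`smul_eq_of_restricts_of_mem_torsionPoints`),
   so `c(x)` fixes `M⁻¹𝔞/𝔞` and lies in `I^{(M)}` by `IdeleAction.stabilizer_torsionPoints_eq` (Silverman's Lemma 9.3);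
2. (`continuous_unitEmbedding_comp`) hence `x ↦ α(x) ∈ K^× ⊂ (𝔸_{K,f})^×` is CONTINUOUS (`f` is continuous and the `I^{(M)}` are a
   basis of neighbourhoods of `1`, `IdeleAction.exists_congruenceUnits_subset_of_mem_nhds`);
3. (private `finite_of_compactSpace_of_countable`, Baire) a countable compact Hausdorff group is finite, so `α` maps the compact group of
   idèles `(1_∞, u)`, `u` a unit finite idèle (`IdeleIdeal.isCompact_ker_toIdealUnits`), onto a FINITE subgroup of `K^×`: its
   values there are roots of unity;
4. a root of unity `≡ 1 (mod 3)` is `1` (`NumberFields.rootOfUnityCongruence`, B-p13), and `α(k_𝐚^×) = 1` (`[y, k] = 1` for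
   `y ∈ k_𝐚^×`, `k ⊇ K*` being totally imaginary, and the uniqueness of the multiplier); so `Ker(α) ⊇ V_3 ∩ 𝕌_k`, an open subgroup.

RESULT: **`isOpen_ker_of_torsion_reciprocity`** — for ANY homomorphism `α : k_𝐀^× →* K^×` satisfying the lattice clause
«`α(x)f(x)⁻¹𝔞 = 𝔞`» and the reciprocity relation of Thm. 19.8 for every Artin lift (the conclusion of FILE B2's
`exists_hom_torsion_reciprocity`), `Ker(α)` is open; and `apply_infiniteIdeles_eq_one` («`α(x) = 1` for `x ∈ k_𝐚^×`», Prop. 19.10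
proof).  Packaged with FILE B2: **`exists_hom_torsion_reciprocity_isOpen_ker`** = Theorem 19.8 without the norm clause.

## References
* [Shimura1998] G. Shimura, *Abelian Varieties with Complex Multiplication and Modular Functions*, Princeton 1998, Thm. 19.8 and its
  proof pp. 134–136 («Ker(α) is open»), Prop. 19.10 (proof, «α(x) = 1 for x ∈ k_𝐚^×»), §18.6 p. 165 («M > 2»).
* [Silverman1994] J. H. Silverman, *Advanced Topics in the Arithmetic of Elliptic Curves*, Ch. II §9 Lemma 9.3.
* [NeukirchANT1999] J. Neukirch, *Algebraic Number Theory*, Ch. VI §1 (1.7)–(1.8).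
-/

set_option autoImplicit false

noncomputable section

open CategoryTheory IsDedekindDomain NumberField Topology
open scoped NumberField nonZeroDivisors

namespace Literature.NumberTheory.ComplexMultiplication

open Literature.AlgebraicGeometry.Motives
open Literature.NumberTheory.GaloisRepresentations
open Literature.NumberTheory.NumberFields (ideleArtinMap continuous_ideleArtinMap ideleArtinMap_infiniteIdeles)
open Literature.NumberTheory.NumberFields.IdeleAction (ideleMulIdeal ideleMulEquiv congruenceUnits
  exists_ideleMulEquiv_mk_eq_mk ideleMulEquiv_mk_eq_mk_iff_of_eq)
open Literature.NumberTheory.AdelicBaseChange (ideleRelNorm continuous_ideleRelNorm)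

/-! ## §1 A countable compact Hausdorff group is finite (Baire) -/

/-- **A countable compact Hausdorff topological group is finite**: by the Baire category theorem some singleton has non-empty
interior, so singletons are open (homogeneity) and the compact discrete space is finite. [folklore] -/
private theorem finite_of_compactSpace_of_countable {G : Type*} [Group G] [TopologicalSpace G] [IsTopologicalGroup G]
    [CompactSpace G] [T2Space G] [Countable G] : Finite G := by
  obtain ⟨g, hg⟩ := nonempty_interior_of_iUnion_of_closed (X := G) (f := fun g : G => ({g} : Set G))
    (fun _ => isClosed_singleton) (Set.eq_univ_of_forall fun x => Set.mem_iUnion.2 ⟨x, rfl⟩)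
  have hopen : IsOpen ({g} : Set G) := by
    obtain ⟨x, hx⟩ := hg
    have hxg : x = g := Set.mem_singleton_iff.1 (interior_subset hx)
    subst hxg
    have heq : interior ({x} : Set G) = {x} := Set.Subset.antisymm interior_subset (Set.singleton_subset_iff.2 hx)
    rw [← heq]
    exact isOpen_interior
  haveI : DiscreteTopology G := by
    refine discreteTopology_of_isOpen_singleton_one ?_
    have h1 : ({1} : Set G) = (Homeomorph.mulLeft g⁻¹) '' {g} := by
      rw [Set.image_singleton]
      change ({1} : Set G) = {g⁻¹ * g}
      rw [inv_mul_cancel]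
    rw [h1]
    exact (Homeomorph.mulLeft g⁻¹).isOpenMap _ hopen
  exact finite_of_compact_of_discrete

/-! ## §2 The multiplier `c(x) = α(x)f(x)⁻¹` near `1`: open subgroups `V_M` with `c(V_M) ⊆ I^{(M)}` -/

section OpenKernel

variable {k : Type} [Field k] [NumberField k] [Algebra k ℂ] {K : Type} [Field K] [NumberField K] [IsCMField K]
  {Φ : CMType K} [NumberField ↥(traceField Φ)] [Algebra ↥(traceField Φ) k]
  {A₀ : AbelianVariety k} {ι₀ : 𝓞 K →+* End A₀} {𝔞 : (FractionalIdeal (𝓞 K)⁰ K)ˣ}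
  (ξ : CMTypeUniformization Φ 𝔞 (A₀.baseChange ℂ) ((A₀.endBaseChange ℂ).comp ι₀))
  (α : ideleGroup k →* Kˣ)
  (hL : ∀ x : ideleGroup k, ideleMulIdeal (FiniteAdeleRing.unitEmbedding (𝓞 K) K (α x) *
      (reflexNormFinitePart K Φ (traceField Φ) (ideleRelNorm (↥(traceField Φ)) k x))⁻¹)
    (𝔞 : FractionalIdeal (𝓞 K)⁰ K) = 𝔞)
  (hR : ∀ (σ : ℂ ≃ₐ[k] ℂ) (x : ideleGroup k), IsArtinLift k x σ → ∀ u v : K,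
    ideleMulEquiv (FiniteAdeleRing.unitEmbedding (𝓞 K) K (α x) *
        (reflexNormFinitePart K Φ (traceField Φ) (ideleRelNorm (↥(traceField Φ)) k x))⁻¹)
      (𝔞 : FractionalIdeal (𝓞 K)⁰ K) 𝔞.ne_zero (Submodule.Quotient.mk u) = Submodule.Quotient.mk v →
    σ • (A₀.pointsMulEquiv ℂ).symm (ξ.r u) = (A₀.pointsMulEquiv ℂ).symm (ξ.r v))

omit [IsCMField K] in
/-- `u ∈ (M)⁻¹𝔞` iff `Mu ∈ 𝔞`, for a positive integer `M`. [folklore] -/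
private theorem mem_inv_span_natCast_mul_iff {M : ℕ} (hM : M ≠ 0) (u : K) :
    u ∈ ((Ideal.span {(M : 𝓞 K)} : Ideal (𝓞 K)) : FractionalIdeal (𝓞 K)⁰ K)⁻¹ * (𝔞 : FractionalIdeal (𝓞 K)⁰ K) ↔
      (M : K) * u ∈ (𝔞 : FractionalIdeal (𝓞 K)⁰ K) := by
  have hMK : (M : K) ≠ 0 := Nat.cast_ne_zero.2 hM
  rw [FractionalIdeal.coeIdeal_span_singleton, show (algebraMap (𝓞 K) K (M : 𝓞 K)) = (M : K) from map_natCast _ M,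
    FractionalIdeal.spanSingleton_inv, FractionalIdeal.mem_singleton_mul]
  constructor
  · rintro ⟨y, hy, rfl⟩
    rwa [mul_inv_cancel_left₀ hMK]
  · intro h
    exact ⟨(M : K) * u, h, by rw [inv_mul_cancel_left₀ hMK]⟩

include hL hR in
/-- **Step 1.  For every `M ≥ 1` there is an open subgroup `V_M` of `k_𝐀^×` on which the multiplier `α(x)f(x)⁻¹` lies in the
congruence subgroup `I^{(M)}`**: `V_M = [·, k]⁻¹(image of Gal(k̄/k(A₀[M])))`; for `x ∈ V_M` an Artin lift of `x` fixes `A₀[M](ℂ)`, so by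
the reciprocity relation `α(x)f(x)⁻¹` fixes `M⁻¹𝔞/𝔞`, i.e. lies in `I^{(M)}` (Silverman's Lemma 9.3, `IdeleAction.stabilizer_torsionPoints_eq`).
[cite: Shimura1998, Thm. 19.8 (proof) p. 136 («for w ∈ m⁻¹𝔞/𝔞 we have r(w) = r(w)^σ = r(αf(x)⁻¹w)»)] [cite: Silverman1994, Ch. II §9 Lemma 9.3] -/
theorem exists_isOpen_subgroup_forall_mem_congruenceUnits {M : ℕ} (hM : M ≠ 0) :
    ∃ V : Subgroup (ideleGroup k), IsOpen (V : Set (ideleGroup k)) ∧ (∀ y : (InfiniteAdeleRing k)ˣ, infiniteIdeles k y ∈ V) ∧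
      ∀ x ∈ V, FiniteAdeleRing.unitEmbedding (𝓞 K) K (α x) *
          (reflexNormFinitePart K Φ (traceField Φ) (ideleRelNorm (↥(traceField Φ)) k x))⁻¹ ∈
        congruenceUnits (K := K) (Ideal.span {(M : 𝓞 K)}) := by
  haveI := isTotallyComplex_of_algebra_traceField K Φ (k := k)
  let e : AlgebraicClosure k →ₐ[k] ℂ := IsAlgClosed.lift
  letI : Algebra (AlgebraicClosure k) ℂ := (e : AlgebraicClosure k →+* ℂ).toAlgebra
  haveI : IsScalarTower k (AlgebraicClosure k) ℂ := IsScalarTower.of_algebraMap_eq fun y => (e.commutes y).symm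
  set H : Subgroup (Field.absoluteGaloisGroup k) := A₀.torsionFixingSubgroup M with hH
  refine ⟨(H.map (absGaloisAbProj k)).comap (ideleArtinMap k), ?_, fun y => ?_, fun x hx => ?_⟩
  · -- open: `H` open, `Γ_k → Γ_k^ab` an open map, `[·, k]` continuous
    rw [Subgroup.coe_comap, Subgroup.coe_map]
    exact ((QuotientGroup.isOpenMap_coe (A₀.torsionFixingSubgroup M : Set (Field.absoluteGaloisGroup k))
      (A₀.isOpen_torsionFixingSubgroup M hM))).preimage (continuous_ideleArtinMap k)
  · rw [Subgroup.mem_comap, ideleArtinMap_infiniteIdeles]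
    exact one_mem _
  · obtain ⟨γ, hγH, hγx⟩ := Subgroup.mem_map.1 (Subgroup.mem_comap.1 hx)
    -- an Artin lift `σ` of `x` extending `γ ∈ Gal(k̄/k(A₀[M]))`
    obtain ⟨σ, hσ⟩ := exists_algEquiv_apply_embedding_eq e γ
    have hlift : IsArtinLift k x σ := ⟨e, γ, fun y => (hσ y).symm, hγx⟩
    have hMk : ((M : ℤ) : k) ≠ 0 := by exact_mod_cast hM
    -- `σ` fixes `A₀[M](ℂ)`
    have hfix : ∀ P ∈ A₀.torsionPoints ℂ (M : ℤ), σ • P = P := fun P hP =>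
      AbelianVariety.smul_eq_of_restricts_of_mem_torsionPoints A₀ ℂ hMk σ
        (Field.absoluteGaloisGroup.toAlgEquiv k γ) hσ hP fun Q hQ => by
          have h := AbelianVariety.mem_torsionFixingSubgroup_iff.1 hγH (Additive.ofMul Q)
            ((AbelianVariety.mem_geomTorsion_iff _).2 hQ)
          exact congrArg Additive.toMul h
    -- hence the multiplier fixes `M⁻¹𝔞/𝔞`
    set c := FiniteAdeleRing.unitEmbedding (𝓞 K) K (α x) *
      (reflexNormFinitePart K Φ (traceField Φ) (ideleRelNorm (↥(traceField Φ)) k x))⁻¹ with hc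
    have hspan : (Ideal.span {(M : 𝓞 K)} : Ideal (𝓞 K)) ≠ ⊥ := by
      rw [Ne, Ideal.span_singleton_eq_bot]; exact_mod_cast hM
    rw [← Literature.NumberTheory.NumberFields.IdeleAction.stabilizer_torsionPoints_eq 𝔞.ne_zero hspan,
      Literature.NumberTheory.NumberFields.IdeleAction.mem_stabilizer_iff]
    refine ⟨hL x, fun u hu => ?_⟩
    rw [Literature.NumberTheory.NumberFields.IdeleAction.mk_mem_torsionPoints_iff hspan,
      mem_inv_span_natCast_mul_iff (𝔞 := 𝔞) hM] at hu
    obtain ⟨v, hv, -⟩ := exists_ideleMulEquiv_mk_eq_mk c 𝔞.ne_zero u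
    have h1 : σ • (A₀.pointsMulEquiv ℂ).symm (ξ.r u) = (A₀.pointsMulEquiv ℂ).symm (ξ.r v) := hR σ x hlift u v hv
    rw [hfix _ (pointsMulEquiv_symm_r_mem_torsionPoints ξ M hu), (A₀.pointsMulEquiv ℂ).symm.injective.eq_iff,
      ξ.r_eq_r_iff] at h1
    rw [ideleMulEquiv_mk_eq_mk_iff_of_eq c 𝔞.ne_zero hv, hL x]
    have : v - u = -(u - v) := by ring
    rw [this]
    exact (𝔞 : FractionalIdeal (𝓞 K)⁰ K).coeToSubmodule.neg_mem h1

include ξ hL hR in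
/-- **Step 2.  `x ↦ α(x) ∈ K^× ⊂ (𝔸_{K,f})^×` is continuous**: `α = c · f` with `f = g(N_{k/K*}·)_𝐡` continuous and `c(V_M) ⊆ I^{(M)}`, the
`I^{(M)}` being cofinal among the neighbourhoods of `1` (`IdeleAction.exists_congruenceUnits_subset_of_mem_nhds`); a homomorphism
continuous at `1` is continuous. [cite: Shimura1998, Thm. 19.8 (proof) p. 136] [cite: NeukirchANT1999, Ch. VI §1 Prop. (1.8)] -/
theorem continuous_unitEmbedding_comp :
    Continuous ((FiniteAdeleRing.unitEmbedding (𝓞 K) K).comp α) := by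
  have hf : Continuous fun x : ideleGroup k =>
      reflexNormFinitePart K Φ (traceField Φ) (ideleRelNorm (↥(traceField Φ)) k x) :=
    (continuous_reflexNormFinitePart K Φ (traceField Φ)).comp (continuous_ideleRelNorm (↥(traceField Φ)) k)
  refine continuous_of_continuousAt_one _ ?_
  rw [ContinuousAt, map_one, Filter.tendsto_def]
  intro U hU
  obtain ⟨𝔪, h𝔪, h𝔪U⟩ := Literature.NumberTheory.NumberFields.IdeleAction.exists_congruenceUnits_subset_of_mem_nhds hU
  -- pass to the cofinal principal level `(M)`, `M = N(𝔪)`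
  have hM : Ideal.absNorm 𝔪 ≠ 0 := fun h => h𝔪 (Ideal.absNorm_eq_zero_iff.1 h)
  have hle : Ideal.span {((Ideal.absNorm 𝔪 : ℕ) : 𝓞 K)} ≤ 𝔪 := (Ideal.span_singleton_le_iff_mem _).2 (Ideal.absNorm_mem 𝔪)
  have hne : Ideal.span {((Ideal.absNorm 𝔪 : ℕ) : 𝓞 K)} ≠ ⊥ := by
    rw [Ne, Ideal.span_singleton_eq_bot]; exact_mod_cast hM
  obtain ⟨V, hVopen, -, hV⟩ := exists_isOpen_subgroup_forall_mem_congruenceUnits ξ α hL hR hM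
  -- on `V ∩ f⁻¹(I^{(M)})`, `α = c·f ∈ I^{(M)} ⊆ I^𝔪 ⊆ U`
  set 𝔟 : Ideal (𝓞 K) := Ideal.span {((Ideal.absNorm 𝔪 : ℕ) : 𝓞 K)} with h𝔟
  have hWopen : IsOpen ((V : Set (ideleGroup k)) ∩ (fun x : ideleGroup k =>
      reflexNormFinitePart K Φ (traceField Φ) (ideleRelNorm (↥(traceField Φ)) k x)) ⁻¹'
        (congruenceUnits (K := K) 𝔟 : Set (FiniteAdeleRing (𝓞 K) K)ˣ)) :=
    hVopen.inter ((Literature.NumberTheory.NumberFields.IdeleAction.isOpen_congruenceUnits 𝔟).preimage hf)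
  have h1mem : (1 : ideleGroup k) ∈ (V : Set (ideleGroup k)) ∩ (fun x : ideleGroup k =>
      reflexNormFinitePart K Φ (traceField Φ) (ideleRelNorm (↥(traceField Φ)) k x)) ⁻¹'
        (congruenceUnits (K := K) 𝔟 : Set (FiniteAdeleRing (𝓞 K) K)ˣ) := by
    refine ⟨SetLike.mem_coe.2 (one_mem V), ?_⟩
    rw [Set.mem_preimage, map_one, map_one]
    exact SetLike.mem_coe.2 (one_mem _)
  refine Filter.mem_of_superset (hWopen.mem_nhds h1mem) fun x hx => ?_
  obtain ⟨hxV, hxf⟩ := hx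
  change (FiniteAdeleRing.unitEmbedding (𝓞 K) K) (α x) ∈ U
  refine h𝔪U (Literature.NumberTheory.NumberFields.FiniteIdeleClosure.congruenceUnits_mono K hne hle ?_)
  have h := mul_mem (hV x hxV) hxf
  rwa [inv_mul_cancel_right] at h

/-! ## §3 «`α(x) = 1` for `x ∈ k_𝐚^×`» -/

omit [IsCMField K] in
/-- `K^× → (𝔸_{K,f})^×` is injective (`K → 𝔸_{K,f}` is, at any finite place). [folklore] -/
private theorem unitEmbedding_injective'' : Function.Injective (FiniteAdeleRing.unitEmbedding (𝓞 K) K) := by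
  refine Units.map_injective (f := (algebraMap K (FiniteAdeleRing (𝓞 K) K) : K →* FiniteAdeleRing (𝓞 K) K)) ?_
  obtain ⟨M, hM⟩ := Ideal.exists_maximal (𝓞 K)
  let v : HeightOneSpectrum (𝓞 K) :=
    ⟨M, hM.isPrime, Ring.ne_bot_of_isMaximal_of_not_isField hM (RingOfIntegers.not_isField K)⟩
  intro a a' h
  have h' := congrArg (fun z : FiniteAdeleRing (𝓞 K) K => z v) h
  simp only [MonoidHom.coe_coe, FiniteAdeleRing.algebraMap_apply] at h'
  exact (algebraMap K (v.adicCompletion K)).injective h'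

include hL hR in
/-- **«If `x ∈ k_𝐚^×`, we have `[x, k] = id.` … and hence `α(x) = 1`»** (Prop. 19.10, proof): `1 ∈ Aut(ℂ/k)` is an Artin lift of an
infinite idèle (`[y, k] = 1`, `k ⊇ K*` totally imaginary: `ideleArtinMap_infiniteIdeles`), `f(y) = 1`, and the multiplier of `1` is `1`
(uniqueness, FILE B2). [cite: Shimura1998, Prop. 19.10 (proof) p. 136 («If x ∈ k_𝐚^× … α(x) = 1»)] -/
theorem apply_infiniteIdeles_eq_one (y : (InfiniteAdeleRing k)ˣ) : α (infiniteIdeles k y) = 1 := by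
  haveI := isTotallyComplex_of_algebra_traceField K Φ (k := k)
  have hlift : IsArtinLift k (infiniteIdeles k y) (1 : ℂ ≃ₐ[k] ℂ) :=
    isArtinLift_one_one.of_ideleArtinMap_eq (by rw [map_one, ideleArtinMap_infiniteIdeles])
  have hf1 : reflexNormFinitePart K Φ (traceField Φ) (ideleRelNorm (↥(traceField Φ)) k (infiniteIdeles k y)) = 1 :=
    reflexNormFinitePart_ideleRelNorm_eq_one_of_snd_eq_one K Φ (y := infiniteIdeles k y) rfl
  have h1 := eq_of_smul_pointsMulEquiv_symm_r_eq ξ (hL (infiniteIdeles k y)) (hR 1 _ hlift) (c' := 1)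
    (Literature.NumberTheory.NumberFields.IdeleAction.ideleMulIdeal_one _)
    (fun u v huv => by
      rw [one_smul, (ξ.r_eq_r_iff u v).2]
      have h := (Submodule.Quotient.eq _).1
        ((Literature.NumberTheory.NumberFields.IdeleAction.ideleMulEquiv_one_mk 𝔞.ne_zero u).symm.trans huv)
      rwa [Literature.NumberTheory.NumberFields.IdeleAction.ideleMulIdeal_one] at h)
  rw [hf1, inv_one, mul_one, ← (FiniteAdeleRing.unitEmbedding (𝓞 K) K).map_one] at h1
  exact unitEmbedding_injective'' h1

/-! ## §4 «`Ker(α)` is open» -/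

omit [NumberField K] [IsCMField K] in
/-- `K^×` is countable. [folklore] -/
private theorem countable_units [NumberField K] : Countable Kˣ :=
  haveI : Countable K := Countable.of_equiv _ (Module.finBasis ℚ K).equivFun.toEquiv.symm
  Function.Injective.countable (f := (Units.val : Kˣ → K)) Units.val_injective

omit [IsCMField K] in
/-- **A unit of `K` lying in `I^{(3)}` and of finite order is `1`**: it is an integer `≡ 1 (mod 3)` of finite order
(`NumberFields.RingOfIntegers.eq_one_of_isOfFinOrder_of_exists_eq_one_add`, B-p13). [cite: Shimura1998, §18.6 p. 165 («M > 2») and Thm. 19.8 (proof) p. 136 («Since m > 2 we have α = 1»)] -/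
theorem eq_one_of_isOfFinOrder_of_unitEmbedding_mem_congruenceUnits {a : Kˣ} (ha : IsOfFinOrder a)
    (hmem : FiniteAdeleRing.unitEmbedding (𝓞 K) K a ∈ congruenceUnits (K := K) (Ideal.span {(3 : 𝓞 K)})) : a = 1 := by
  rw [Literature.NumberTheory.NumberFields.IdeleAction.mem_congruenceUnits_iff] at hmem
  -- `a` and `(a - 1)/3` are integral
  have hval : ∀ v : HeightOneSpectrum (𝓞 K), v.valuation K (a : K) = 1 := fun v => by
    have h := (Literature.NumberTheory.Automorphic.FiniteAdeleRing.unitOrd_eq_zero_iff _ v).1 (hmem v).1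
    rwa [FiniteAdeleRing.unitEmbedding_apply, FiniteAdeleRing.algebraMap_apply,
      HeightOneSpectrum.valuedAdicCompletion_eq_valuation'] at h
  have h3 : (algebraMap (𝓞 K) K (3 : 𝓞 K)) = 3 := map_ofNat _ 3
  have h30 : (3 : K) ≠ 0 := three_ne_zero
  have hval' : ∀ v : HeightOneSpectrum (𝓞 K), v.valuation K (((a : K) - 1) / 3) ≤ 1 := fun v => by
    have h := (hmem v).2
    have e1 : ((FiniteAdeleRing.unitEmbedding (𝓞 K) K a : (FiniteAdeleRing (𝓞 K) K)ˣ) : FiniteAdeleRing (𝓞 K) K) v - 1 =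
        (algebraMap K (FiniteAdeleRing (𝓞 K) K) ((a : K) - 1)) v := by
      rw [FiniteAdeleRing.unitEmbedding_apply, map_sub, map_one, Literature.NumberTheory.Automorphic.FiniteAdeleRing.sub_apply']; rfl
    rw [e1, FiniteAdeleRing.algebraMap_apply, HeightOneSpectrum.valuedAdicCompletion_eq_valuation',
      FractionalIdeal.coeIdeal_span_singleton, h3, show (3 : K) = ((Units.mk0 (3 : K) h30 : Kˣ) : K) from rfl,
      Literature.NumberTheory.Automorphic.FractionalIdeal.count_spanSingleton_eq_neg_log_valuation, neg_neg,
      WithZero.exp_log ((Valuation.ne_zero_iff _).2 (Units.mk0 (3 : K) h30).ne_zero), Units.val_mk0] at h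
    rw [map_div₀, div_le_one₀ (zero_lt_iff.2 ((Valuation.ne_zero_iff _).2 h30))]
    exact h
  obtain ⟨ε, hε⟩ := HeightOneSpectrum.mem_integers_of_valuation_le_one K (a : K) fun v => (hval v).le
  obtain ⟨c, hc⟩ := HeightOneSpectrum.mem_integers_of_valuation_le_one K (((a : K) - 1) / 3) hval'
  -- `ε` has finite order in `𝓞 K`
  have hεfin : IsOfFinOrder ε := by
    obtain ⟨n, hn, han⟩ := isOfFinOrder_iff_pow_eq_one.1 ha
    refine isOfFinOrder_iff_pow_eq_one.2 ⟨n, hn, RingOfIntegers.coe_injective ?_⟩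
    change algebraMap (𝓞 K) K (ε ^ n) = algebraMap (𝓞 K) K 1
    rw [map_pow, hε, map_one, ← Units.val_pow_eq_pow_val, han, Units.val_one]
  have hε1 : ε = 1 :=
    Literature.NumberTheory.NumberFields.RingOfIntegers.eq_one_of_isOfFinOrder_of_exists_eq_one_add (M := 3) le_rfl hεfin
      ⟨c, by
        change (algebraMap (𝓞 K) K ε) = 1 + (3 : ℕ) * (algebraMap (𝓞 K) K c)
        rw [hε, hc]; push_cast; field_simp; ring⟩
  ext
  rw [← hε, hε1, map_one, Units.val_one]

include ξ hL hR in
/-- **«`Ker(α)` is open in `k_𝐀^×`» (Shimura Thm. 19.8, last clause) — from the reciprocity relation and the lattice clause alone.**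
For a homomorphism `α : k_𝐀^× → K^×` satisfying the conclusion of FILE B2's `exists_hom_torsion_reciprocity` (in particular for the `α`
of Thm. 19.8 obtained from `shimura1998_thm18_6`), the kernel is open: it contains `V_3 ∩ 𝕌_k` (steps 1–4 of the module docstring:
continuity of `α` into the finite idèles of `K`, finiteness of the image of the compact unit idèles by Baire, roots of unity `≡ 1 (3)`,
`α(k_𝐚^×) = 1`). [cite: Shimura1998, Thm. 19.8 («Ker(α) is open in k_𝐀^×») and its proof p. 136] -/
theorem isOpen_ker_of_torsion_reciprocity : IsOpen (α.ker : Set (ideleGroup k)) := by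
  haveI := isTotallyComplex_of_algebra_traceField K Φ (k := k)
  -- the continuous homomorphism `β = ι_K ∘ α` and the compact group `C` of idèles `(1_∞, u)`, `u` a unit finite idèle
  set β : ideleGroup k →* (FiniteAdeleRing (𝓞 K) K)ˣ := (FiniteAdeleRing.unitEmbedding (𝓞 K) K).comp α with hβ
  have hβc : Continuous β := continuous_unitEmbedding_comp ξ α hL hR
  have hfin : Continuous (finiteIdeles k) := Continuous.units_map _ (continuous_const.prodMk continuous_id)
  set S : Subgroup (FiniteAdeleRing (𝓞 K) K)ˣ :=
    ((Literature.NumberTheory.NumberFields.IdeleIdeal.toIdealUnits (𝓞 k) k).ker).map (β.comp (finiteIdeles k)) with hS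
  have hScpt : IsCompact (S : Set (FiniteAdeleRing (𝓞 K) K)ˣ) := by
    rw [hS, Subgroup.coe_map]
    exact (Literature.NumberTheory.NumberFields.IdeleIdeal.isCompact_ker_toIdealUnits (L := k)).image (hβc.comp hfin)
  have hScount : (S : Set (FiniteAdeleRing (𝓞 K) K)ˣ).Countable := by
    haveI := countable_units (K := K)
    refine (Set.countable_range (FiniteAdeleRing.unitEmbedding (𝓞 K) K)).mono ?_
    intro t ht
    obtain ⟨z, -, rfl⟩ := Subgroup.mem_map.1 ht
    exact ⟨α (finiteIdeles k z), rfl⟩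
  -- Baire: `S` is finite, so `α` has finite-order values on `C`
  haveI : T2Space (FiniteAdeleRing (𝓞 K) K) := inferInstanceAs <| T2Space
    (RestrictedProduct (fun w : HeightOneSpectrum (𝓞 K) => w.adicCompletion K)
      (fun w => (w.adicCompletionIntegers K : Set (w.adicCompletion K))) Filter.cofinite)
  haveI : CompactSpace S := isCompact_iff_compactSpace.1 hScpt
  haveI : Countable S := hScount.to_subtype
  haveI : Finite S := finite_of_compactSpace_of_countable
  have hord : ∀ z ∈ (Literature.NumberTheory.NumberFields.IdeleIdeal.toIdealUnits (𝓞 k) k).ker, IsOfFinOrder (α (finiteIdeles k z)) := by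
    intro z hz
    have h1 : IsOfFinOrder (⟨β (finiteIdeles k z), Subgroup.mem_map_of_mem _ hz⟩ : S) := isOfFinOrder_of_finite _
    have h1' : IsOfFinOrder (β (finiteIdeles k z)) :=
      (Submonoid.isOfFinOrder_coe (H := S.toSubmonoid) (x := ⟨β (finiteIdeles k z), Subgroup.mem_map_of_mem _ hz⟩)).2 h1
    obtain ⟨n, hn, hzn⟩ := isOfFinOrder_iff_pow_eq_one.1 h1'
    refine isOfFinOrder_iff_pow_eq_one.2 ⟨n, hn, unitEmbedding_injective'' ?_⟩
    rw [map_pow, map_one]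
    exact hzn
  -- the open subgroup `V_3 ∩ 𝕌_k ∩ f⁻¹(I^{(3)})` lies in the kernel
  set fh : ideleGroup k →* (FiniteAdeleRing (𝓞 K) K)ˣ :=
    (reflexNormFinitePart K Φ (traceField Φ)).comp (ideleRelNorm (↥(traceField Φ)) k) with hfh_def
  have hfhc : Continuous fh :=
    (continuous_reflexNormFinitePart K Φ (traceField Φ)).comp (continuous_ideleRelNorm (↥(traceField Φ)) k)
  obtain ⟨V, hVopen, hVinf, hV⟩ := exists_isOpen_subgroup_forall_mem_congruenceUnits ξ α hL hR (M := 3) three_ne_zero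
  have h3 : ((3 : ℕ) : 𝓞 K) = 3 := by norm_num
  rw [h3] at hV
  apply Subgroup.isOpen_mono (H₁ := V ⊓ unitIdeles k ⊓ (congruenceUnits (K := K) (Ideal.span {(3 : 𝓞 K)})).comap fh) ?_
    ((hVopen.inter (isOpen_unitIdeles k)).inter
      ((Literature.NumberTheory.NumberFields.IdeleAction.isOpen_congruenceUnits _).preimage hfhc))
  intro x hx
  obtain ⟨hx1, hxf⟩ := Subgroup.mem_inf.1 hx
  obtain ⟨hxV, hxU⟩ := Subgroup.mem_inf.1 hx1
  rw [Subgroup.mem_comap] at hxf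
  rw [MonoidHom.mem_ker]
  -- `x = x_∞ · (1_∞, x_𝐡)`, `α(x_∞) = 1`, `f(x_∞) = 1`
  set xinf := infiniteIdeles k (Units.map (RingHom.fst (InfiniteAdeleRing k) (FiniteAdeleRing (𝓞 k) k)).toMonoidHom x) with hxinf
  set z := Literature.NumberTheory.NumberFields.IdeleAction.finitePart k x with hz
  have hdec : x = xinf * finiteIdeles k z := eq_infiniteIdeles_mul_finiteIdeles_finitePart x
  rw [hdec, map_mul, apply_infiniteIdeles_eq_one ξ α hL hR, one_mul]
  have hzU : z ∈ (Literature.NumberTheory.NumberFields.IdeleIdeal.toIdealUnits (𝓞 k) k).ker := by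
    have h := hxU
    rw [Literature.NumberTheory.NumberFields.unitIdeles_eq_comap_ker, Subgroup.mem_comap] at h
    exact h
  have hzeq : finiteIdeles k z = xinf⁻¹ * x := by rw [eq_inv_mul_iff_mul_eq]; exact hdec.symm
  have hzV : finiteIdeles k z ∈ V := by rw [hzeq]; exact mul_mem (inv_mem (hVinf _)) hxV
  have hfz : fh (finiteIdeles k z) ∈ congruenceUnits (K := K) (Ideal.span {(3 : 𝓞 K)}) := by
    rw [hzeq, map_mul, map_inv]
    have h1 : fh xinf = 1 := reflexNormFinitePart_ideleRelNorm_eq_one_of_snd_eq_one K Φ (y := xinf) rfl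
    rw [h1, inv_one, one_mul]
    exact hxf
  -- `α(1_∞, x_𝐡)` is a root of unity `≡ 1 (mod 3)`
  refine eq_one_of_isOfFinOrder_of_unitEmbedding_mem_congruenceUnits (hord z hzU) ?_
  have h2 := mul_mem (hV _ hzV) hfz
  have hfh : fh (finiteIdeles k z) =
      reflexNormFinitePart K Φ (traceField Φ) (ideleRelNorm (↥(traceField Φ)) k (finiteIdeles k z)) := rfl
  rwa [hfh, inv_mul_cancel_right] at h2

end OpenKernel

end Literature.NumberTheory.ComplexMultiplication

end
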